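import Summits.KontsevichZagierPeriods.KontsevichZagierPeriods.Theorems.RootDecompQuadraticDescentPair18HomotopyGridP1

/-! # `RootDecompQuadraticDescentPair18HomotopyGridP2` — part 2/5 of the mechanical ≤400-line split of `Grid_landing.lean` (sha256 c1ef4f0ae5c58233…)
Source: decomp-kz lens-6 g10 `Pair18HomotopyGrid.lean` (file #4; HOME/decomp-kz-lens-6/g10/, sha256 f97d8f44…; critic g5-19 CLEARED «census pair #18 = THEOREM, no hypothesis left»): hGrid_of_charts (hTh7) (hB17) : 4•[B11] − [Th7] − [B17] − 2•[PB7] ∈ KZ.relations — the nine-cell W₇-chart scissors congruence (7 cuts, 4 swaps, 4 inversions x ↦ 1/(7x) via W7_invert, linear cov); landed by census-1 g9 over the landed files #1/#2/#3 (copied prelude dropped, homonyms suffixed G, pins removed).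
Split by census-1 g9 `gen/splitlean.py`: scopes re-opened with their `open`/`variable`/`set_option` context; mathematics and declaration order unchanged. -/

set_option linter.unusedSimpArgs false
noncomputable section
open _root_.Set MvPolynomial
namespace Summit.KontsevichZagierPeriods.RootDecompQuadraticDescent.Pair18Homotopy
open Literature.NumberTheory.Transcendental
open Literature.NumberTheory.Transcendental.KZ (RFun cube)
open Summit.KontsevichZagierPeriods.RootDecompQuadraticDescent.DarkPairs (rel_reflect_rep rel_double)
section Fold
open Literature.ModelTheory.ExponentialFields (IsSemialgebraic isSemialgebraic_setOf_eval_le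
  isSemialgebraic_setOf_eval_pos isSemialgebraic_setOf_eval_nonneg isSemialgebraic_setOf_eval_eq_zero)
open _root_.Set MvPolynomial in
open Literature.NumberTheory.Transcendental in
open Literature.NumberTheory.Transcendental.KZ (RFun cube) in
open Summit.KontsevichZagierPeriods.RootDecompQuadraticDescent.DarkPairs (rel_reflect_rep rel_double) in
/-- Auxiliary step `vec2_1` (§2b): vec2 1. [bookkeeping] -/
private theorem vec2_1 (a b : ℝ) : (![a, b] : Fin 2 → ℝ) 1 = b := rfl

open _root_.Set MvPolynomial in
open Literature.NumberTheory.Transcendental in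
open Literature.NumberTheory.Transcendental.KZ (RFun cube) in
open Summit.KontsevichZagierPeriods.RootDecompQuadraticDescent.DarkPairs (rel_reflect_rep rel_double) in
/-- Auxiliary step `vec2_0` (§2b): vec2 0. [bookkeeping] -/
private theorem vec2_0 (a b : ℝ) : (![a, b] : Fin 2 → ℝ) 0 = a := rfl

open _root_.Set MvPolynomial in
open Literature.NumberTheory.Transcendental in
open Literature.NumberTheory.Transcendental.KZ (RFun cube) in
open Summit.KontsevichZagierPeriods.RootDecompQuadraticDescent.DarkPairs (rel_reflect_rep rel_double) in
/-- Auxiliary step `cube2` (§0): cube2. [bookkeeping] -/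
private theorem cube2 {x : Fin 2 → ℝ} (hx : x ∈ KZ.cube 2) : (0 ≤ x 0 ∧ x 0 ≤ 1) ∧ (0 ≤ x 1 ∧ x 1 ≤ 1) := ⟨hx 0, hx 1⟩

namespace Grid

/-! ### the seven cuts -/
/-- Auxiliary step `cutA`: cut A. [bookkeeping] -/
theorem cutA : KZ.of W7cube - KZ.of W7KA - KZ.of W7K3 ∈ KZ.relations :=
  rel_cut W7cube W7KA W7K3 (fun z => 7 * (z 0 * z 0)) 1 rfl rfl volume_xx_one (fun _ _ => rfl) (fun _ _ => rfl)
/-- Auxiliary step `cutKA`: cut KA. [bookkeeping] -/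
theorem cutKA : KZ.of W7KA - KZ.of W7Bsq - KZ.of W7AJ3 ∈ KZ.relations :=
  rel_cut W7KA W7Bsq W7AJ3 (fun z => 7 * (z 1 * z 1)) 1 rfl rfl volume_yy_one (fun _ _ => rfl) (fun _ _ => rfl)
/-- Auxiliary step `cutK3`: cut K3. [bookkeeping] -/
theorem cutK3 : KZ.of W7K3 - KZ.of W7J3A - KZ.of W7J33 ∈ KZ.relations :=
  rel_cut W7K3 W7J3A W7J33 (fun z => 7 * (z 1 * z 1)) 1 rfl rfl volume_yy_one (fun _ _ => rfl) (fun _ _ => rfl)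
/-- Auxiliary step `cutC1`: cut C1. [bookkeeping] -/
theorem cutC1 : KZ.of W7C1 - KZ.of W7J1A - KZ.of W7J13 ∈ KZ.relations :=
  rel_cut W7C1 W7J1A W7J13 (fun z => 7 * (z 1 * z 1)) 1 rfl rfl volume_yy_one (fun _ _ => rfl) (fun _ _ => rfl)
/-- Auxiliary step `cutJ2`: cut J2. [bookkeeping] -/
theorem cutJ2 : KZ.of W7J2A - KZ.of W7C21 - KZ.of W7C22 ∈ KZ.relations :=
  rel_cut W7J2A W7C21 W7C22 (fun z => 7 * z 1) 1 rfl rfl volume_y_one (fun _ _ => rfl) (fun _ _ => rfl)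
/-- Auxiliary step `J1A_eq`: J1 A eq. [bookkeeping] -/
theorem J1A_eq : W7J1A.domain = W7Bsq.domain ∩ {z | 7 * z 0 ≤ 1} := by
  ext z
  simp only [W7J1A, W7Bsq, J1A, Bsq, KA, C1, sX7, sXX7, sYY7, KZ.IntegralRep.domain_restrict, mem_inter_iff,
    mem_setOf_eq]
  constructor
  · rintro ⟨⟨hc, hx⟩, hy⟩
    exact ⟨⟨⟨hc, sq_of_lin (cube2 hc).1.1 hx⟩, hy⟩, hx⟩
  · rintro ⟨⟨⟨hc, _⟩, hy⟩, hx⟩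
    exact ⟨⟨hc, hx⟩, hy⟩
/-- Auxiliary step `cutB`: cut B. [bookkeeping] -/
theorem cutB : KZ.of W7Bsq - KZ.of W7J1A - KZ.of W7J2A ∈ KZ.relations :=
  rel_cut W7Bsq W7J1A W7J2A (fun z => 7 * z 0) 1 J1A_eq rfl volume_x_one (fun _ _ => rfl) (fun _ _ => rfl)
/-- Auxiliary step `Sq17_eq`: Sq17 eq. [bookkeeping] -/
theorem Sq17_eq : W7Sq17.domain = W7J1A.domain ∩ {z | 7 * z 1 ≤ 1} := by
  ext z
  simp only [W7J1A, W7Sq17, J1A, Sq17, C1, sX7, sY7, sYY7, KZ.IntegralRep.domain_restrict, mem_inter_iff,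
    mem_setOf_eq]
  constructor
  · rintro ⟨hc, hx, hy⟩
    exact ⟨⟨⟨hc, hx⟩, sq_of_lin (cube2 hc).2.1 hy⟩, hy⟩
  · rintro ⟨⟨⟨hc, hx⟩, _⟩, hy⟩
    exact ⟨hc, hx, hy⟩
/-- Auxiliary step `cutJ1`: cut J1. [bookkeeping] -/
theorem cutJ1 : KZ.of W7J1A - KZ.of W7Sq17 - KZ.of W7C12 ∈ KZ.relations :=
  rel_cut W7J1A W7Sq17 W7C12 (fun z => 7 * z 1) 1 Sq17_eq rfl volume_y_one (fun _ _ => rfl) (fun _ _ => rfl)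

/-! ### the four swaps -/
/-- Auxiliary step `swAJ3`: sw AJ3. [bookkeeping] -/
theorem swAJ3 : KZ.of W7AJ3 - KZ.of W7J3A ∈ KZ.relations := by
  refine W7_swap isSemialgebraic_AJ3 isSemialgebraic_J3A (fun _ hz => hz.1.1) (fun _ hz => hz.1.1)
    (fun z hz => ?_) (fun w hw => ?_)
  · obtain ⟨⟨hcu, hx⟩, hy⟩ := hz
    refine ⟨⟨Sw_cube hcu, ?_⟩, ?_⟩
    · show 1 ≤ 7 * (Sw z 0 * Sw z 0); rw [Sw_zero]; exact hy
    · show 7 * (Sw z 1 * Sw z 1) ≤ 1; rw [Sw_one]; exact hx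
  · obtain ⟨⟨hcu, hx⟩, hy⟩ := hw
    refine ⟨⟨Sw_cube hcu, ?_⟩, ?_⟩
    · show 7 * (Sw w 0 * Sw w 0) ≤ 1; rw [Sw_zero]; exact hy
    · show 1 ≤ 7 * (Sw w 1 * Sw w 1); rw [Sw_one]; exact hx
/-- Auxiliary step `swJ23`: sw J23. [bookkeeping] -/
theorem swJ23 : KZ.of W7J23 - KZ.of W7J32 ∈ KZ.relations := by
  refine W7_swap isSemialgebraic_J23 isSemialgebraic_J32 (fun _ hz => hz.1.1.1) (fun _ hz => hz.1.1.1)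
    (fun z hz => ?_) (fun w hw => ?_)
  · obtain ⟨⟨⟨hcu, hx⟩, hy⟩, hx'⟩ := hz
    refine ⟨⟨⟨Sw_cube hcu, ?_⟩, ?_⟩, ?_⟩
    · show 1 ≤ 7 * (Sw z 0 * Sw z 0); rw [Sw_zero]; exact hy
    · show 7 * (Sw z 1 * Sw z 1) ≤ 1; rw [Sw_one]; exact hx
    · show 1 ≤ 7 * Sw z 1; rw [Sw_one]; exact hx'
  · obtain ⟨⟨⟨hcu, hx⟩, hy⟩, hy'⟩ := hw
    refine ⟨⟨⟨Sw_cube hcu, ?_⟩, ?_⟩, ?_⟩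
    · show 7 * (Sw w 0 * Sw w 0) ≤ 1; rw [Sw_zero]; exact hy
    · show 1 ≤ 7 * (Sw w 1 * Sw w 1); rw [Sw_one]; exact hx
    · show 1 ≤ 7 * Sw w 0; rw [Sw_zero]; exact hy'
/-- Auxiliary step `swJ13`: sw J13. [bookkeeping] -/
theorem swJ13 : KZ.of W7J13 - KZ.of W7J31 ∈ KZ.relations := by
  refine W7_swap isSemialgebraic_J13 isSemialgebraic_J31 (fun _ hz => hz.1.1) (fun _ hz => hz.1.1)
    (fun z hz => ?_) (fun w hw => ?_)
  · obtain ⟨⟨hcu, hx⟩, hy⟩ := hz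
    refine ⟨⟨Sw_cube hcu, ?_⟩, ?_⟩
    · show 1 ≤ 7 * (Sw z 0 * Sw z 0); rw [Sw_zero]; exact hy
    · show 7 * Sw z 1 ≤ 1; rw [Sw_one]; exact hx
  · obtain ⟨⟨hcu, hx⟩, hy⟩ := hw
    refine ⟨⟨Sw_cube hcu, ?_⟩, ?_⟩
    · show 7 * Sw w 0 ≤ 1; rw [Sw_zero]; exact hy
    · show 1 ≤ 7 * (Sw w 1 * Sw w 1); rw [Sw_one]; exact hx
/-- Auxiliary step `swC21`: sw C21. [bookkeeping] -/
theorem swC21 : KZ.of W7C21 - KZ.of W7C12 ∈ KZ.relations := by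
  refine W7_swap isSemialgebraic_C21 isSemialgebraic_C12 (fun _ hz => hz.1.1.1.1) (fun _ hz => hz.1.1.1)
    (fun z hz => ?_) (fun w hw => ?_)
  · obtain ⟨⟨⟨⟨hcu, hx⟩, hy⟩, hx'⟩, hy'⟩ := hz
    refine ⟨⟨⟨Sw_cube hcu, ?_⟩, ?_⟩, ?_⟩
    · show 7 * Sw z 0 ≤ 1; rw [Sw_zero]; exact hy'
    · show 7 * (Sw z 1 * Sw z 1) ≤ 1; rw [Sw_one]; exact hx
    · show 1 ≤ 7 * Sw z 1; rw [Sw_one]; exact hx'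
  · obtain ⟨⟨⟨hcu, hx⟩, hy⟩, hy'⟩ := hw
    have h0 := (cube2 hcu).1
    refine ⟨⟨⟨⟨Sw_cube hcu, ?_⟩, ?_⟩, ?_⟩, ?_⟩
    · show 7 * (Sw w 0 * Sw w 0) ≤ 1; rw [Sw_zero]; exact hy
    · show 7 * (Sw w 1 * Sw w 1) ≤ 1; rw [Sw_one]; exact sq_of_lin h0.1 hx
    · show 1 ≤ 7 * Sw w 0; rw [Sw_zero]; exact hy'
    · show 7 * Sw w 1 ≤ 1; rw [Sw_one]; exact hx

/-! ### the inversion `x ↦ 1/(7x)` (swaps `J₂` and `J₃`, preserves `W₇ dx`) -/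
/-- Auxiliary definition `Iv`: Iv. [bookkeeping] -/
def Iv (z : Fin 2 → ℝ) : Fin 2 → ℝ := ![1 / (7 * z 0), z 1]
/-- Auxiliary step `Iv_zero`: Iv zero. [bookkeeping] -/
theorem Iv_zero (z : Fin 2 → ℝ) : Iv z 0 = 1 / (7 * z 0) := rfl
/-- Auxiliary step `Iv_one`: Iv one. [bookkeeping] -/
theorem Iv_one (z : Fin 2 → ℝ) : Iv z 1 = z 1 := rfl
/-- Auxiliary step `Iv_Iv`: Iv Iv. [bookkeeping] -/
theorem Iv_Iv (z : Fin 2 → ℝ) (h : 0 < z 0) : Iv (Iv z) = z := by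
  funext i
  fin_cases i
  · show 1 / (7 * (1 / (7 * z 0))) = z 0
    field_simp
  · rfl

set_option maxHeartbeats 1600000 in
/-- **the inversion as a KZ-move**: for `S, T ⊆ [0,1]²` with `x > 0` on both, `Iv(S) ⊆ T`, `Iv(T) ⊆ S`:
`[W₇ | S] ≡ [W₇ | T]` (`W₇(1/(7x), y)·|d(1/(7x))/dx| = W₇(x, y)`). -/
theorem W7_invert {S T : Set (Fin 2 → ℝ)} (hS : IsSemialgebraic ℚ S) (hT : IsSemialgebraic ℚ T)
    (hSc : S ⊆ cube 2) (hTc : T ⊆ cube 2)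
    (hpos : ∀ z ∈ S, (0:ℝ) < z 0) (hposT : ∀ w ∈ T, (0:ℝ) < w 0)
    (hST : ∀ z ∈ S, Iv z ∈ T) (hTS : ∀ w ∈ T, Iv w ∈ S) :
    KZ.of (W7.rep.restrict S hS hSc) - KZ.of (W7.rep.restrict T hT hTc) ∈ KZ.relations := by
  let M00 : (Fin 2 → ℝ) → ℝ := fun z => -(1 / (7 * (z 0 * z 0)))
  let Mz : (Fin 2 → ℝ) → Matrix (Fin 2) (Fin 2) ℝ := fun z => !![M00 z, 0; 0, 1]
  let Φ' : (Fin 2 → ℝ) → (Fin 2 → ℝ) →L[ℝ] (Fin 2 → ℝ) := fun z =>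
    LinearMap.toContinuousLinearMap (Matrix.toLin' (Mz z))
  have hΦ'ap : ∀ z w, Φ' z w = ![M00 z * w 0, w 1] := by
    intro z w; funext i
    fin_cases i <;> simp [Φ', Mz, Matrix.toLin'_apply, Matrix.mulVec, dotProduct, Fin.sum_univ_two]
  have hdet : ∀ z, (Φ' z).det = M00 z := by
    intro z
    unfold ContinuousLinearMap.det
    simp [Φ', LinearMap.det_toLin', Mz, Matrix.det_fin_two]
  have hdom : (W7.rep.restrict T hT hTc).domain = Iv '' (W7.rep.restrict S hS hSc).domain := by
    simp only [KZ.IntegralRep.domain_restrict]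
    ext w
    constructor
    · intro hw
      exact ⟨Iv w, hTS w hw, Iv_Iv w (hposT w hw)⟩
    · rintro ⟨z, hz, rfl⟩
      exact hST z hz
  refine KZ.changeOfVariablesRel_subset_relations
    ⟨2, W7.rep.restrict S hS hSc, W7.rep.restrict T hT hTc, Iv, Φ', ?_, ?_, ?_, hdom, ?_, rfl⟩
  · have hsd : IsSemialgebraic ℚ (W7.rep.restrict S hS hSc).domain :=
      (W7.rep.restrict S hS hSc).isSemialgebraic_domain
    refine (isSemialgebraicMapOn_iff_forall_holds hsd).mpr fun i => ?_
    fin_cases i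
    · refine (isSemialgebraicFunOn_aeval_div_aeval hsd (C 1) (C 7 * X 0) fun z hz => ?_).congr
        fun z _ => ?_
      · have hz' : z ∈ S := by simpa [KZ.IntegralRep.domain_restrict] using hz
        have hD := hpos z hz'
        simp only [map_mul, aeval_C, aeval_X, eq_ratCast, Rat.cast_ofNat]
        linarith
      · simp only [Iv, Fin.zero_eta, Matrix.cons_val_zero, map_mul, aeval_C, aeval_X, eq_ratCast,
          Rat.cast_ofNat, Rat.cast_one]
    · exact (isSemialgebraicFunOn_aeval hsd (X 1)).congr fun z _ => by
        simp only [Iv, Fin.mk_one, Matrix.cons_val_one, Matrix.head_cons, Matrix.cons_val_fin_one, aeval_X]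
  · intro z hz
    have hz' : z ∈ S := by simpa [KZ.IntegralRep.domain_restrict] using hz
    have hDp := hpos z hz'
    have hDne : (7 * z 0) ≠ 0 := by positivity
    have hA := hasFDerivAt_apply (𝕜 := ℝ) 0 z
    have hB := hasFDerivAt_apply (𝕜 := ℝ) 1 z
    have hDen := hA.const_mul (7:ℝ)
    have hinv := (hasDerivAt_inv hDne).comp_hasFDerivAt z hDen
    have hpi : HasFDerivAt Iv (Φ' z) z := by
      rw [hasFDerivAt_pi']
      intro i
      fin_cases i
      · refine (hinv.congr_fderiv ?_).congr_of_eventuallyEq (Filter.Eventually.of_forall fun y => ?_)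
        · ext w
          simp [hΦ'ap, M00]
          field_simp
        · simp only [Fin.zero_eta, Iv_zero, Function.comp_apply, one_div]
      · refine (hB.congr_fderiv ?_).congr_of_eventuallyEq (Filter.Eventually.of_forall fun y => ?_)
        · ext w
          simp [hΦ'ap]
        · simp only [Fin.mk_one, Iv_one]
    exact hpi.hasFDerivWithinAt
  · intro z₁ hz₁ z₂ hz₂ heq
    have hz₁' : z₁ ∈ S := by simpa [KZ.IntegralRep.domain_restrict] using hz₁
    have hz₂' : z₂ ∈ S := by simpa [KZ.IntegralRep.domain_restrict] using hz₂
    have h := congr_arg Iv heq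
    rwa [Iv_Iv z₁ (hpos z₁ hz₁'), Iv_Iv z₂ (hpos z₂ hz₂')] at h
  · intro z hz
    have hz' : z ∈ S := by simpa [KZ.IntegralRep.domain_restrict] using hz
    have hDp := hpos z hz'
    have hM : M00 z < 0 := by
      show -(1 / (7 * (z 0 * z 0))) < 0
      have : 0 < 1 / (7 * (z 0 * z 0)) := by positivity
      linarith
    rw [hdet z, abs_of_neg hM]
    simp only [M00, neg_neg]
    simp only [KZ.IntegralRep.integrand_restrict, RFun.rep_integrand]
    simp only [W7, W7Den, RFun.fn, Iv, map_add, map_sub, map_mul, aeval_C, aeval_X, eq_ratCast, Rat.cast_one,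
      Rat.cast_ofNat, vec2_0, vec2_1, Matrix.cons_val_zero, Matrix.cons_val_one, Matrix.head_cons]
    have h1 : (0:ℝ) < 1 + 7 * z 0 * z 0 := by nlinarith [mul_self_nonneg (z 0)]
    have h2 : (0:ℝ) < 1 + 7 * z 1 * z 1 := by nlinarith [mul_self_nonneg (z 1)]
    have h1ne := h1.ne'
    have h2ne := h2.ne'
    have hz0ne := hDp.ne'
    field_simp
    ring

end Grid
end Fold
end Summit.KontsevichZagierPeriods.RootDecompQuadraticDescent.Pair18Homotopy
end
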